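import Summits.HubbardSuperconductivity.HubbardSuperconductivity.Theorems.ThermalWedgeTwSourcedInertnessReduction
import Summits.HubbardSuperconductivity.HubbardSuperconductivity.Theorems.ThermalWedgeTwTipContinuationEdgeOrderBCSExpectations
import Summits.HubbardSuperconductivity.HubbardSuperconductivity.Theorems.TwTipContinuation.Negative.SeededChords
import Literature.MathematicalPhysics.QuantumLattice.DWaveSourceFreePressure
import Literature.MathematicalPhysics.QuantumLattice.HubbardWave0RepulsiveProofs
import Literature.MathematicalPhysics.QuantumLattice.TorusCooperSum
import Literature.MathematicalPhysics.QuantumLattice.ApproximateEigenvectorLemmas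

/-!
# Route `ThermalWedge`, item `TwExponentialCeiling` (stmt-HubbardSuperconductivity-1704):
# the Slater thermal bound — hypothesis (T) of the ceiling functor with slack `2|U|`

Support file (`--supports stmt-HubbardSuperconductivity-1704`). The ceiling functor
`twec_ceilingEngineAt` (`ThermalWedgeTwExponentialCeilingEngine.lean`) turns a thermal upper bound
(T) `e_L(0) + p_L(β,μ,U,0) − μN_L/L² ≤ log 4/β + ε + D'` and a sourced-gain bound (G) into a ceiling
on the every-ground-state `d`-wave order of the pure torus. Here (T) is PROVED with slack
`D' = 2|U|`, up to a level-counting error, for every `L ≥ 3`, real `U`, `|μ| ≤ 4`, `β > 0`, `n ≤ L²`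
(`thermalBound_slater`):

  `E_L^{(2n,0)}(H_U)/L² + p_L(β,μ,U,0) − 2μn/L² ≤ log 4/β + 16·|#{ε_L ≤ μ} − n|/L² + 2|U|`.

Mechanism (no ensemble equivalence, no thermodynamic limit):
* `exists_slater_trialState` — the plane-wave Slater determinant `Π_{k∈S} c†_{k↑}c†_{−k↓}|0⟩`
  (the BCS product state of `…EdgeOrderProductState` with coefficients in `{0,1}`) is a unit vector
  of the sector `(2|S|, S^z=0)` (zero number variance ⇒ number eigenvector; spin balance) with free
  kinetic energy `2Σ_{k∈S} ε_L(k)`;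
* `sectorEnergy_le_slater` — variational principle plus `‖U Σ_x n_{x↑}n_{x↓}‖ ≤ |U|L²`;
* `freePressure_le` — the BdG formula `Z₀ = Π_k (1 + e^{−βξ_k})²` (`DWaveSourceFreePressure`) gives
  `p_L(β,μ,0,0) ≤ (2/L²)Σ_k (μ − ε_L(k))₊ + log 4/β`; and `|p_U − p_0| ≤ |U|`;
* `exists_slaterSet` — choosing `S` (`|S| = n`) nested with the Fermi set `{ε_L ≤ μ}` makes the
  chemical-potential mismatch `Σ_{k∈S}(ε_L(k) − μ) + Σ_k(μ − ε_L(k))₊` at most `8·|#{ε_L ≤ μ} − n|`;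
* `countingError_small` — the error `16|#{ε_L ≤ μ} − ⌊(1−δ)L²/2⌋|/L²` is eventually `≤ ε` once
  `#{ε_L ≤ μ}/L² → (1−δ)/2` (the Weyl law, `Literature…TorusBandFillingWindow`).

Sources: Griffiths (1965) / Ruelle (1969) §2.5 (variational and Gibbs bounds); Bardeen–Cooper–
Schrieffer (1957) §II (product states); von Delft–Ralph (2001) §4.2 (BdG partition function).
-/

noncomputable section

namespace Summit.HubbardSuperconductivity.HubbardSuperconductivity.Theorems

open Literature.MathematicalPhysics.QuantumLattice Matrix Finset Filter Topology
open Literature.Probability.LatticeModels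
open Summit.HubbardSuperconductivity.TwTipContinuation.Negative
open Summit.HubbardSuperconductivity.TwTipContinuation.IsogapTransport
open scoped ComplexOrder Matrix.Norms.L2Operator

section Slater

variable {L : ℕ} [NeZero L]

/-- **Plane-wave Slater determinants in the `(2n, S^z=0)` sector.** For `L ≥ 3` and a set `S` of
torus momenta, the product vector `Π_{k∈S} b†_k |0⟩` (`b†_k = c†_{k↑}c†_{−k↓}`; the BCS product state
with coefficients `(u_k,v_k) = (0,1)` on `S` and `(1,0)` off `S`) is a unit vector of the sector
`(2|S|, S^z = 0)` with free kinetic energy `2 Σ_{k∈S} ε_L(k)`. [folklore] -/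
theorem exists_slater_trialState (hL : 3 ≤ L) (S : Finset (TorusSite 2 L)) :
    ∃ Ψ : Fock (Orb (FermionTorus 2 L)), star Ψ ⬝ᵥ Ψ = 1 ∧
      Ψ ∈ szSector (Λ := FermionTorus 2 L) (2 * S.card) (0 : ℝ) ∧
      (expect (hubbardTorus 2 L 1 0) Ψ).re = 2 * ∑ k ∈ S, torusBand L k := by
  classical
  set u : TorusSite 2 L → ℝ := fun k => if k ∈ S then 0 else 1 with hu
  set v : TorusSite 2 L → ℝ := fun k => if k ∈ S then 1 else 0 with hv
  have huv : ∀ k, u k ^ 2 + v k ^ 2 = 1 := fun k => by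
    by_cases h : k ∈ S <;> simp [hu, hv, h]
  have hv2 : ∀ k, v k ^ 2 = if k ∈ S then 1 else 0 := fun k => by
    by_cases h : k ∈ S <;> simp [hv, h]
  set Ψ : Fock (Orb (FermionTorus 2 L)) :=
    (List.map (fun k => ((u k : ℝ) : ℂ) •
        (1 : Matrix (Finset (Orb (FermionTorus 2 L))) (Finset (Orb (FermionTorus 2 L))) ℂ) +
        ((v k : ℝ) : ℂ) • (pairMode k)ᴴ) (Finset.univ : Finset (TorusSite 2 L)).toList).prod *ᵥ
      (vacuum : Fock (Orb (FermionTorus 2 L))) with hΨ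
  have hnorm : star Ψ ⬝ᵥ Ψ = 1 := star_prodState_dotProduct_self u v huv (Finset.nodup_toList _)
  -- mean particle number `Σ_k 2 v_k² = 2|S|`
  have hNbar : (∑ k : TorusSite 2 L, 2 * (v k) ^ 2 : ℝ) = 2 * S.card := by
    simp_rw [hv2]
    rw [← Finset.mul_sum, Finset.sum_boole]
    simp
  -- zero number variance: `Ψ` is a number eigenvector
  have hvar := variance_totalNumber_prodState u v huv
  have hvar0 : (∑ k : TorusSite 2 L, (4 * (v k) ^ 2 - 4 * (v k) ^ 4) : ℝ) = 0 := by
    refine Finset.sum_eq_zero fun k _ => ?_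
    have : v k ^ 4 = (v k ^ 2) ^ 2 := by ring
    rw [this, hv2]
    by_cases h : k ∈ S <;> simp [h]
  rw [hvar0, Complex.ofReal_zero, dotProduct_star_self_eq_zero, sub_eq_zero, hNbar] at hvar
  have hN : IsNParticle (2 * S.card) Ψ := by
    rw [LiebTwo.isNParticle_iff_totalNumber, hΨ]
    convert hvar using 2
    push_cast
    ring
  have hbal : Ψ ∈ spinBalanced := prodState_mem_spinBalanced u v _
  refine ⟨Ψ, hnorm, ?_, ?_⟩
  · rw [mem_szSector_iff]
    refine ⟨hN, ?_⟩
    rw [spinZ_mulVec_eq_zero_of_mem_spinBalanced hbal, Complex.ofReal_zero, zero_smul]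
  · rw [hubbardTorus_zero_eq_sum_momentumNumber hL, Literature.MathematicalPhysics.QuantumLattice.expect,
      hΨ, expect_oneBody_prodState u v huv (torusBand L), Complex.ofReal_re]
    have hneg : ∑ k : TorusSite 2 L, torusBand L k * v (-k) ^ 2 =
        ∑ k : TorusSite 2 L, torusBand L k * v k ^ 2 := by
      rw [← Equiv.sum_comp (Equiv.neg (TorusSite 2 L))
        (fun k => torusBand L k * v k ^ 2)]
      refine Finset.sum_congr rfl fun k _ => ?_
      simp only [Equiv.neg_apply, torusBand_neg]
    simp_rw [mul_add]
    rw [Finset.sum_add_distrib, hneg, ← two_mul]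
    congr 1
    simp_rw [hv2, mul_ite, mul_one, mul_zero]
    rw [Finset.sum_ite_mem, Finset.univ_inter]

/-- **Variational (Slater) upper bound on the interacting sector energy**: for `L ≥ 3`, any real
`U` and any set `S` of momenta, `E_L^{(2|S|,0)}(hubbardTorus 2 L 1 U) ≤ 2 Σ_{k∈S} ε_L(k) + |U|·L²`
(kinetic energy of the Slater determinant plus `‖U Σ_x n_{x↑}n_{x↓}‖ ≤ |U| L²`). [folklore] -/
theorem sectorEnergy_le_slater (hL : 3 ≤ L) (U : ℝ) (S : Finset (TorusSite 2 L)) :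
    (hubbardTorus 2 L 1 U).minEnergyOn (szSector (Λ := FermionTorus 2 L) (2 * S.card) (0 : ℝ)) ≤
      2 * ∑ k ∈ S, torusBand L k + |U| * (L : ℝ) ^ 2 := by
  obtain ⟨Ψ, h1, hsec, hkin⟩ := exists_slater_trialState hL S
  have hS : S.card ≤ Fintype.card (FermionTorus 2 L) := by
    rw [Fintype.card_congr (FermionTorus.equivTorusSite (d := 2) (L := L))]
    exact Finset.card_le_univ S
  obtain ⟨-, hb⟩ := seeded_sector_groundState U 0 L hS
  rw [seededH_zero] at hb
  have hvar := hb Ψ hsec h1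
  -- split off the interaction
  have hsplit : hubbardTorus 2 L 1 U = hubbardTorus 2 L 1 0 + (hubbardTorus 2 L 1 U - hubbardTorus 2 L 1 0) := by
    abel
  have hint : (expect (hubbardTorus 2 L 1 U - hubbardTorus 2 L 1 0) Ψ).re ≤ |U| * (L : ℝ) ^ 2 := by
    have hnorm : ‖hubbardTorus 2 L 1 U - hubbardTorus 2 L 1 0‖ ≤ |U| * (L : ℝ) ^ 2 := by
      have := norm_dWaveSourceTorus_sub_free_le L U 0 0
      simpa only [dWaveSourceTorus_zero, hubbardTorusWith_zero] using this
    calc (expect (hubbardTorus 2 L 1 U - hubbardTorus 2 L 1 0) Ψ).re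
        ≤ ‖expect (hubbardTorus 2 L 1 U - hubbardTorus 2 L 1 0) Ψ‖ := Complex.re_le_norm _
      _ ≤ eucNorm ((hubbardTorus 2 L 1 U - hubbardTorus 2 L 1 0) *ᵥ Ψ) :=
          norm_star_dotProduct_le_eucNorm h1 _
      _ ≤ ‖hubbardTorus 2 L 1 U - hubbardTorus 2 L 1 0‖ * eucNorm Ψ := eucNorm_mulVec_le _ _
      _ = ‖hubbardTorus 2 L 1 U - hubbardTorus 2 L 1 0‖ := by rw [eucNorm_eq_one h1, mul_one]
      _ ≤ |U| * (L : ℝ) ^ 2 := hnorm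
  have hexp : expect (hubbardTorus 2 L 1 U) Ψ = expect (hubbardTorus 2 L 1 0) Ψ +
      expect (hubbardTorus 2 L 1 U - hubbardTorus 2 L 1 0) Ψ := by
    rw [expect_sub']; ring
  rw [hexp, Complex.add_re, hkin] at hvar
  linarith

/-- `log ((1 + cosh y)/2) ≤ |y|`. [folklore] -/
theorem log_one_add_cosh_div_two_le (y : ℝ) : Real.log ((1 + Real.cosh y) / 2) ≤ |y| := by
  have h1 : 1 ≤ Real.cosh y := Real.one_le_cosh y
  have hpos : 0 < (1 + Real.cosh y) / 2 := by positivity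
  have hcosh : Real.cosh y ≤ Real.exp |y| := by
    rw [Real.cosh_eq]
    have e1 : Real.exp y ≤ Real.exp |y| := Real.exp_le_exp.2 (le_abs_self y)
    have e2 : Real.exp (-y) ≤ Real.exp |y| := Real.exp_le_exp.2 (neg_le_abs y)
    linarith
  calc Real.log ((1 + Real.cosh y) / 2) ≤ Real.log (Real.exp |y|) := by
        refine Real.log_le_log hpos ?_
        linarith
    _ = |y| := Real.log_exp _

/-- **Free grand-canonical pressure bound** (`L ≥ 3`, `β > 0`):
`log Tr e^{-β(H₀ - μN)} / (βL²) ≤ (2/L²) Σ_k (μ - ε_L(k))₊ + log 4/β` — the BdG formula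
`Z₀ = Π_k (1 + e^{-βξ_k})²` at zero source and `log(1 + e^{-βξ}) ≤ β(-ξ)₊ + log 2`. [folklore] -/
theorem freePressure_le (hL : 3 ≤ L) (μ : ℝ) {β : ℝ} (hβ : 0 < β) :
    Real.log (partitionFn β (hubbardTorusWith 2 L 1 0 μ)).re / (β * (L : ℝ) ^ 2) ≤
      (2 / (L : ℝ) ^ 2) * ∑ k : TorusSite 2 L, max (μ - torusBand L k) 0 + Real.log 4 / β := by
  have hLpos : (0 : ℝ) < (L : ℝ) := by exact_mod_cast NeZero.pos L
  have hL2 : (0 : ℝ) < (L : ℝ) ^ 2 := by positivity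
  have hβL : 0 < β * (L : ℝ) ^ 2 := mul_pos hβ hL2
  rw [← dWaveSourceTorus_zero L 0 μ, partitionFn_dWaveSourceTorus_zero_re hL β μ 0,
    card_orb_fermionTorus_two]
  have hfac_pos : ∀ k : TorusSite 2 L, 0 < Real.exp (-(β * (torusBand L k - μ))) *
      ((1 + Real.cosh (β * Real.sqrt ((torusBand L k - μ) ^ 2 +
        (2 * Real.sqrt 2 * 0 * dWaveGap k) ^ 2))) / 2) := fun k => bdgModeFactor_pos β _ _
  have hfac_le : ∀ k : TorusSite 2 L, Real.log (Real.exp (-(β * (torusBand L k - μ))) *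
      ((1 + Real.cosh (β * Real.sqrt ((torusBand L k - μ) ^ 2 +
        (2 * Real.sqrt 2 * 0 * dWaveGap k) ^ 2))) / 2)) ≤ 2 * β * max (μ - torusBand L k) 0 := by
    intro k
    have hsq : Real.sqrt ((torusBand L k - μ) ^ 2 + (2 * Real.sqrt 2 * 0 * dWaveGap k) ^ 2) =
        |torusBand L k - μ| := by
      rw [mul_zero, zero_mul, zero_pow two_ne_zero, add_zero, Real.sqrt_sq_eq_abs]
    rw [hsq, Real.log_mul (Real.exp_pos _).ne' (by
      have := Real.one_le_cosh (β * |torusBand L k - μ|); positivity), Real.log_exp]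
    have hl := log_one_add_cosh_div_two_le (β * |torusBand L k - μ|)
    rw [abs_mul, abs_of_pos hβ, abs_abs] at hl
    have hmax : -(β * (torusBand L k - μ)) + β * |torusBand L k - μ| =
        2 * β * max (μ - torusBand L k) 0 := by
      rcases le_or_gt (torusBand L k) μ with h | h
      · rw [abs_of_nonpos (by linarith), max_eq_left (by linarith)]; ring
      · rw [abs_of_pos (by linarith), max_eq_right (by linarith)]; ring
    linarith
  have hprod_pos : 0 < ∏ k : TorusSite 2 L, Real.exp (-(β * (torusBand L k - μ))) *
      ((1 + Real.cosh (β * Real.sqrt ((torusBand L k - μ) ^ 2 +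
        (2 * Real.sqrt 2 * 0 * dWaveGap k) ^ 2))) / 2) :=
    Finset.prod_pos fun k _ => hfac_pos k
  rw [Real.log_mul (by positivity) hprod_pos.ne', Real.log_pow,
    Real.log_prod (s := Finset.univ) (hf := fun k _ => (hfac_pos k).ne')]
  have hsum : ∑ k : TorusSite 2 L, Real.log (Real.exp (-(β * (torusBand L k - μ))) *
      ((1 + Real.cosh (β * Real.sqrt ((torusBand L k - μ) ^ 2 +
        (2 * Real.sqrt 2 * 0 * dWaveGap k) ^ 2))) / 2)) ≤
      ∑ k : TorusSite 2 L, 2 * β * max (μ - torusBand L k) 0 := Finset.sum_le_sum fun k _ => hfac_le k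
  rw [← Finset.mul_sum] at hsum
  have hlog4 : ((2 * L ^ 2 : ℕ) : ℝ) * Real.log 2 = (L : ℝ) ^ 2 * Real.log 4 := by
    rw [show (4 : ℝ) = 2 ^ 2 by norm_num, Real.log_pow]; push_cast; ring
  rw [hlog4, div_le_iff₀ hβL]
  have e : ((2 / (L : ℝ) ^ 2) * ∑ k : TorusSite 2 L, max (μ - torusBand L k) 0 + Real.log 4 / β) *
      (β * (L : ℝ) ^ 2) = 2 * β * ∑ k : TorusSite 2 L, max (μ - torusBand L k) 0 +
        (L : ℝ) ^ 2 * Real.log 4 := by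
    field_simp
  rw [e]
  linarith

/-- **The Slater set matching a chemical potential.** For `|μ| ≤ 4` and `n ≤ L²` there is a set
`S` of `n` momenta, nested with the Fermi set `{ε_L ≤ μ}`, whose chemical-potential mismatch
`Σ_{k∈S}(ε_L(k) − μ) + Σ_k (μ − ε_L(k))₊` is at most `8·|#{ε_L ≤ μ} − n|`. [folklore] -/
theorem exists_slaterSet (μ : ℝ) (hμ : |μ| ≤ 4) {n : ℕ} (hn : n ≤ Fintype.card (TorusSite 2 L)) :
    ∃ S : Finset (TorusSite 2 L), S.card = n ∧
      ∑ k ∈ S, (torusBand L k - μ) + ∑ k : TorusSite 2 L, max (μ - torusBand L k) 0 ≤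
        8 * |(torusLevelCount L μ : ℝ) - n| := by
  classical
  rw [abs_le] at hμ
  set A : Finset (TorusSite 2 L) := univ.filter fun k => torusBand L k ≤ μ with hA
  have hAcard : A.card = torusLevelCount L μ := by rw [torusLevelCount_def]
  have hmemA : ∀ k, k ∈ A ↔ torusBand L k ≤ μ := fun k => by simp [hA]
  -- pointwise bound for ANY `S` nested with `A`
  have hpt : ∀ (S : Finset (TorusSite 2 L)) (k : TorusSite 2 L),
      (if k ∈ S then torusBand L k - μ else 0) + max (μ - torusBand L k) 0 ≤
        8 * ((if k ∈ A \ S then 1 else 0) + (if k ∈ S \ A then 1 else 0)) := by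
    intro S k
    have hb1 := neg_four_le_torusBand L k
    have hb2 := torusBand_le_four L k
    by_cases hkS : k ∈ S <;> by_cases hkA : k ∈ A
    · have hle := (hmemA k).1 hkA
      rw [if_pos hkS, max_eq_left (by linarith), if_neg (by simp [hkS]), if_neg (by simp [hkA])]
      linarith
    · have hgt := not_le.1 (mt (hmemA k).2 hkA)
      rw [if_pos hkS, max_eq_right (by linarith), if_neg (by simp [hkS]), if_pos (by simp [hkS, hkA])]
      linarith
    · have hle := (hmemA k).1 hkA
      rw [if_neg hkS, max_eq_left (by linarith), if_pos (by simp [hkS, hkA]), if_neg (by simp [hkS])]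
      linarith
    · have hgt := not_le.1 (mt (hmemA k).2 hkA)
      rw [if_neg hkS, max_eq_right (by linarith), if_neg (by simp [hkA]), if_neg (by simp [hkS])]
      linarith
  have hsum : ∀ S : Finset (TorusSite 2 L),
      ∑ k ∈ S, (torusBand L k - μ) + ∑ k : TorusSite 2 L, max (μ - torusBand L k) 0 ≤
        8 * (((A \ S).card : ℝ) + ((S \ A).card : ℝ)) := by
    intro S
    have h1 : ∑ k ∈ S, (torusBand L k - μ) =
        ∑ k : TorusSite 2 L, (if k ∈ S then torusBand L k - μ else 0) := by
      rw [Finset.sum_ite_mem, Finset.univ_inter]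
    rw [h1, ← Finset.sum_add_distrib]
    refine (Finset.sum_le_sum fun k _ => hpt S k).trans ?_
    rw [← Finset.mul_sum, Finset.sum_add_distrib]
    have e1 : ∑ k : TorusSite 2 L, (if k ∈ A \ S then (1 : ℝ) else 0) = ((A \ S).card : ℝ) := by
      rw [Finset.sum_ite_mem, Finset.univ_inter, Finset.sum_const, nsmul_eq_mul, mul_one]
    have e2 : ∑ k : TorusSite 2 L, (if k ∈ S \ A then (1 : ℝ) else 0) = ((S \ A).card : ℝ) := by
      rw [Finset.sum_ite_mem, Finset.univ_inter, Finset.sum_const, nsmul_eq_mul, mul_one]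
    rw [e1, e2]
  rcases le_or_gt n A.card with hle | hlt
  · obtain ⟨S, hSA, hS⟩ := Finset.exists_subset_card_eq hle
    refine ⟨S, hS, (hsum S).trans ?_⟩
    have h1 : (A \ S).card = A.card - n := by rw [Finset.card_sdiff_of_subset hSA, hS]
    have h2 : (S \ A).card = 0 := by
      rw [Finset.card_eq_zero, Finset.sdiff_eq_empty_iff_subset]; exact hSA
    rw [h1, h2, ← hAcard, Nat.cast_sub hle]
    have : (0 : ℝ) ≤ (A.card : ℝ) - n := by
      have : (n : ℝ) ≤ A.card := by exact_mod_cast hle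
      linarith
    rw [abs_of_nonneg this]
    push_cast
    linarith
  · obtain ⟨S, hAS, hS⟩ := Finset.exists_superset_card_eq hlt.le hn
    refine ⟨S, hS, (hsum S).trans ?_⟩
    have h1 : (S \ A).card = n - A.card := by rw [Finset.card_sdiff_of_subset hAS, hS]
    have h2 : (A \ S).card = 0 := by
      rw [Finset.card_eq_zero, Finset.sdiff_eq_empty_iff_subset]; exact hAS
    rw [h1, h2, ← hAcard, Nat.cast_sub hlt.le]
    have : (A.card : ℝ) - n ≤ 0 := by
      have : (A.card : ℝ) < n := by exact_mod_cast hlt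
      linarith
    rw [abs_of_nonpos this]
    push_cast
    linarith

/-- **The Slater thermal bound.** For `L ≥ 3`, any real `U`, `|μ| ≤ 4`, `β > 0` and `n ≤ L²`:
`E_L^{(2n,0)}(H_U)/L² + p_L(β,μ,U,0) − μ·2n/L² ≤ log 4/β + 16|#{ε_L ≤ μ} − n|/L² + 2|U|`
(Slater trial state at the matching set, free pressure bound, `|p_U − p_0| ≤ |U|`). This is
hypothesis (T) of the ceiling functor with slack `D' = 2|U|`, up to the counting error. [folklore] -/
theorem thermalBound_slater (hL : 3 ≤ L) (U : ℝ) {μ β : ℝ} (hμ : |μ| ≤ 4) (hβ : 0 < β) {n : ℕ}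
    (hn : n ≤ L ^ 2) :
    (hubbardTorus 2 L 1 U).minEnergyOn (szSector (Λ := FermionTorus 2 L) (2 * n) (0 : ℝ)) /
          (L : ℝ) ^ 2 +
        Real.log (partitionFn β (hubbardTorusWith 2 L 1 U μ)).re / (β * (L : ℝ) ^ 2) -
        μ * ((2 * n : ℕ) : ℝ) / (L : ℝ) ^ 2 ≤
      Real.log 4 / β + 16 * |(torusLevelCount L μ : ℝ) - n| / (L : ℝ) ^ 2 + 2 * |U| := by
  have hLpos : (0 : ℝ) < (L : ℝ) := by exact_mod_cast NeZero.pos L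
  have hL2 : (0 : ℝ) < (L : ℝ) ^ 2 := by positivity
  have hn' : n ≤ Fintype.card (TorusSite 2 L) := by rwa [card_torusSite_two]
  obtain ⟨S, hS, hmis⟩ := exists_slaterSet μ hμ hn'
  have hE := sectorEnergy_le_slater hL U S
  rw [hS] at hE
  have hp0 := freePressure_le hL μ hβ
  have hpU : Real.log (partitionFn β (hubbardTorusWith 2 L 1 U μ)).re / (β * (L : ℝ) ^ 2) ≤
      Real.log (partitionFn β (hubbardTorusWith 2 L 1 0 μ)).re / (β * (L : ℝ) ^ 2) + |U| := by
    have h := abs_sourcedPressure_interacting_sub_free_le L U μ 0 hβ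
    rw [dWaveSourceTorus_zero, dWaveSourceTorus_zero, abs_le] at h
    linarith [h.2]
  -- bookkeeping
  have hcast : μ * ((2 * n : ℕ) : ℝ) = 2 * (μ * n) := by push_cast; ring
  have hsumS : ∑ k ∈ S, (torusBand L k - μ) = ∑ k ∈ S, torusBand L k - μ * n := by
    rw [Finset.sum_sub_distrib, Finset.sum_const, hS, nsmul_eq_mul, mul_comm]
  have key : (2 * ∑ k ∈ S, torusBand L k + |U| * (L : ℝ) ^ 2) / (L : ℝ) ^ 2 +
      ((2 / (L : ℝ) ^ 2) * ∑ k : TorusSite 2 L, max (μ - torusBand L k) 0 + Real.log 4 / β + |U|) -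
      2 * (μ * n) / (L : ℝ) ^ 2 ≤
      Real.log 4 / β + 16 * |(torusLevelCount L μ : ℝ) - n| / (L : ℝ) ^ 2 + 2 * |U| := by
    have e : (2 * ∑ k ∈ S, torusBand L k + |U| * (L : ℝ) ^ 2) / (L : ℝ) ^ 2 +
        ((2 / (L : ℝ) ^ 2) * ∑ k : TorusSite 2 L, max (μ - torusBand L k) 0 + Real.log 4 / β + |U|) -
        2 * (μ * n) / (L : ℝ) ^ 2 =
        (2 / (L : ℝ) ^ 2) * (∑ k ∈ S, (torusBand L k - μ) +
          ∑ k : TorusSite 2 L, max (μ - torusBand L k) 0) + Real.log 4 / β + 2 * |U| := by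
      rw [hsumS]
      field_simp
      ring
    rw [e]
    have := mul_le_mul_of_nonneg_left hmis (by positivity : (0 : ℝ) ≤ 2 / (L : ℝ) ^ 2)
    have e2 : 2 / (L : ℝ) ^ 2 * (8 * |(torusLevelCount L μ : ℝ) - n|) =
        16 * |(torusLevelCount L μ : ℝ) - n| / (L : ℝ) ^ 2 := by
      field_simp; ring
    linarith
  have hE' := div_le_div_of_nonneg_right hE hL2.le
  rw [hcast]
  linarith

end Slater

/-! ### From the Weyl law to the thermal bound (T), and the unconditional Legendre ceiling -/

/-- The counting error `16 |#{ε_L ≤ μ} − ⌊(1−δ)L²/2⌋| / L²` tends to zero when the fraction of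
levels below `μ` tends to `(1 − δ)/2`. [folklore] -/
theorem countingError_small {δ μ : ℝ} (hδ : δ ≤ 1)
    (hcount : Tendsto (fun L : ℕ => (torusLevelCount (L + 1) μ : ℝ) / (((L + 1 : ℕ) : ℝ) ^ 2))
      atTop (𝓝 ((1 - δ) / 2))) :
    ∀ ε : ℝ, 0 < ε → ∃ L₀ : ℕ, ∀ (L : ℕ) [NeZero L], L₀ ≤ L →
      16 * |(torusLevelCount L μ : ℝ) - (⌊(1 - δ) * (L : ℝ) ^ 2 / 2⌋₊ : ℕ)| / (L : ℝ) ^ 2 ≤ ε := by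
  intro ε hε
  rw [Metric.tendsto_atTop] at hcount
  obtain ⟨N, hN⟩ := hcount (ε / 32) (by positivity)
  obtain ⟨M, hM⟩ := exists_nat_gt (32 / ε)
  refine ⟨max (N + 1) (M + 1), fun L _ hL => ?_⟩
  have hLN : N + 1 ≤ L := (le_max_left _ _).trans hL
  have hLM : M + 1 ≤ L := (le_max_right _ _).trans hL
  obtain ⟨n, rfl⟩ : ∃ n, L = n + 1 := ⟨L - 1, by omega⟩
  have hn := hN n (by omega)
  rw [Real.dist_eq] at hn
  have hLpos : (0 : ℝ) < ((n + 1 : ℕ) : ℝ) := by positivity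
  have hL2 : (0 : ℝ) < ((n + 1 : ℕ) : ℝ) ^ 2 := by positivity
  -- the floor is within one of `(1-δ)L²/2`
  set x : ℝ := (1 - δ) * ((n + 1 : ℕ) : ℝ) ^ 2 / 2 with hx
  have hx0 : 0 ≤ x := by
    rw [hx]
    exact div_nonneg (mul_nonneg (by linarith) (by positivity)) (by norm_num)
  have hfl1 : (⌊x⌋₊ : ℝ) ≤ x := Nat.floor_le hx0
  have hfl2 : x < (⌊x⌋₊ : ℝ) + 1 := Nat.lt_floor_add_one x
  -- `|count - x| ≤ (ε/32) L²`
  have hc : |(torusLevelCount (n + 1) μ : ℝ) - x| ≤ ε / 32 * ((n + 1 : ℕ) : ℝ) ^ 2 := by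
    have : |(torusLevelCount (n + 1) μ : ℝ) / ((n + 1 : ℕ) : ℝ) ^ 2 - (1 - δ) / 2| *
        ((n + 1 : ℕ) : ℝ) ^ 2 = |(torusLevelCount (n + 1) μ : ℝ) - x| := by
      rw [← abs_of_pos hL2, ← abs_mul, abs_of_pos hL2]
      congr 1
      rw [hx]; field_simp
    rw [← this]
    exact mul_le_mul_of_nonneg_right hn.le hL2.le
  have hM' : (32 : ℝ) / ε < ((n + 1 : ℕ) : ℝ) := by
    have : (M : ℝ) + 1 ≤ ((n + 1 : ℕ) : ℝ) := by exact_mod_cast hLM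
    linarith
  have hbig : 32 ≤ ε * ((n + 1 : ℕ) : ℝ) ^ 2 := by
    have h1 : 32 < ε * ((n + 1 : ℕ) : ℝ) := by
      rw [div_lt_iff₀ hε] at hM'; linarith
    have h2 : ((n + 1 : ℕ) : ℝ) ≤ ((n + 1 : ℕ) : ℝ) ^ 2 := by
      have : (1 : ℝ) ≤ ((n + 1 : ℕ) : ℝ) := by exact_mod_cast Nat.succ_le_succ (Nat.zero_le n)
      nlinarith
    nlinarith
  rw [div_le_iff₀ hL2]
  have htri : |(torusLevelCount (n + 1) μ : ℝ) - (⌊x⌋₊ : ℕ)| ≤ ε / 32 * ((n + 1 : ℕ) : ℝ) ^ 2 + 1 := by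
    calc |(torusLevelCount (n + 1) μ : ℝ) - (⌊x⌋₊ : ℕ)|
        ≤ |(torusLevelCount (n + 1) μ : ℝ) - x| + |x - (⌊x⌋₊ : ℕ)| := abs_sub_le _ _ _
      _ ≤ ε / 32 * ((n + 1 : ℕ) : ℝ) ^ 2 + 1 := by
          refine add_le_add hc ?_
          rw [abs_le]; constructor <;> linarith
  nlinarith


end Summit.HubbardSuperconductivity.HubbardSuperconductivity.Theorems
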